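import Summits.HodgeConjecture.CorCM.MultiFieldWeilHodge
import Summits.HodgeConjecture.CorCM.MultiFieldWeilMarkman
import Summits.HodgeConjecture.CorCM.MultiFieldWeilMarkman22
import Summits.HodgeConjecture.CorCM.OcticDecicWeil22Realised
import Summits.HodgeConjecture.CorCM.SexticDecicWeilHodgeOfMarkman
import Summits.HodgeConjecture.CorCM.OcticWeilFourfoldTwoTransitiveOfSimple
import HarnessLib

/-!
# COR-CM — `E × B₄ × B₅` THROUGH THE MULTI-FIELD WEIL ENGINE with a slot of curve multiplicity ZERO: the Hodge conjecture for every product of copies of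
# `E`, a CM fourfold `B₄` of WEIL TYPE (`k`-signature `(2,2)`) over an OCTIC CM field with `2`-transitive quartic part (e.g. `B₄` SIMPLE) and a
# `(2,3)`-fivefold `B₅` over a DECIC CM field sharing `k` — modulo Markman's fourfold and hyperbolic-sixfold theorems, NO hypothesis relating the fields

Cell `pub-hodgecm2` (COR-CM), seat b30 gen 29 (2026-08-24); count-neutral own lane (stem `OcticDecicWeil*`), capstone of `Census/OcticDecicWeil22Defect` →
`CorCM/OcticDecicWeil22Realised` with the engine supplier `CorCM/MultiFieldWeilMarkman22` (`c = 0`).  Theorems only; no definition, no named fact of its own,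
no `sorry`.  HONEST FRAMING: `HC_CM` is NOT proved and not asserted; the displayed deep inputs are the two named facts
`Markman2025_weilClasses_algebraic_abelianFourfold` (the Weil plane of `B₄` itself) and `Markman2025_weilClasses_algebraic_hyperbolicSixfold` (that of `B₅ × E`),
both unrefereed.

THE RESULT (`hodgeConjectureFor_biproduct_comp_vec_of_markman22`, `…_of_isSimple_of_markman22`).  `k` ANY imaginary quadratic field, `K₂ ⊇ i₂(k)` ANY octic,
`K₃ ⊇ i₃(k)` ANY decic CM field; `E ⊨ (k; Ψ)` (`τ ∈ Ψ`), `B₄ ⊨ (K₂; Φ₂)` with exactly TWO members of `Φ₂` over `τ` (so `B₄` is an abelian fourfold of WEIL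
TYPE for `k`) and `Aut(ℂ)` `2`-TRANSITIVE on the four embeddings of `K₂` over `τ` (`h2T`; by Dodson §3.3.2 automatic when `B₄` is SIMPLE — gen 19ʼs
`OcticWeilFourfold.twoTransitive_of_isSimple` BY NAME), `B₅ ⊨ (K₃; Φ₃)` with exactly two members over `τ` (`(2,3)`; or three, `(3,2)`, `…_of_signs`): the
Hodge conjecture for EVERY `E^a × B₄^n × B₅^m` (any order, `⨁_j ![E, B₄, B₅] (κ j)`) and for everything dominated by such a product.  The Hodge rings contain
the Weil classes of the FOURFOLD `B₄`, the SIXFOLD `B₅ × E` and the TENFOLD `B₄ × B̄₅ × E`-type cross parts — all produced by the engine from the two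
single-slot Weil spaces.  The `2`-transitivity hypothesis is NOT idle (a `D₄` quartic part with an edge type carries further Hodge classes on `B₄` — Weil
classes for a second imaginary quadratic subfield — outside this method); nothing is assumed about `K₃` or about the pair `(K₂, K₃)`.

THE PROOF = `MultiFieldWeil.hodgeConjectureFor_biproduct_comp_of_defectLawG` at `n2 = (4,5)`, `P22 = ({0,1},{0,1})`, `c22 = (0,1)`, `w22 = (2,3)` with
`hdef = OcticDecicWeil22.exists_hasDefectsG_realisedTuples22` (realised decic rotation + ordered `2`-transitivity) and `hW = (MultiFieldWeil.weilHyp_of_markman_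
fourfold22, MultiFieldWeil.weilHyp_of_markman_sixfold_decic)`; frames `OcticWeilFourfold.exists_frame₂` (gen 19) and `SexticDecicWeil.exists_frame_fin₂` (gen 27).
[cite: Markman2025SurveySecant, Thm. 1.2] [cite: Markman2025SecantWeil, Thm 1.5.1] [cite: Dodson1984, §3.3.2 Theorem] [cite: Pohlmann1968, Thm 1]
[cite: Milne2020HodgeClassesAV, 1.2 (a) and Thm. 1] [cite: MumfordAV1970, §19]

## References
* [Markman2025SurveySecant] E. Markman, arXiv:2509.23403, Thm. 1.2.  [Markman2025SecantWeil] E. Markman, arXiv:2502.03415, Thm 1.5.1.  [Dodson1984] B. Dodson,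
  Trans. AMS 283 (1984), §3.3.2 Theorem.  [Pohlmann1968] H. Pohlmann, Ann. of Math. 88 (1968), Thm 1.  [Milne2020HodgeClassesAV] J. S. Milne, arXiv:2010.08857,
  1.2 (a), Thm. 1.  [MumfordAV1970] D. Mumford, *Abelian Varieties*, §19.
-/

noncomputable section

open CategoryTheory CategoryTheory.Limits NumberField

namespace Summit.HodgeConjecture.CorCM.OcticDecicWeil22

open Literature.AlgebraicGeometry Literature.AlgebraicGeometry.Motives Literature.AlgebraicGeometry.HodgeTheory
open Literature.AlgebraicGeometry.ComplexMultiplication (IsCMTypeRealisation)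
open Literature.AlgebraicGeometry.Pohlmann1968
open Literature.AlgebraicTopology.SingularHomology
open Literature.NumberTheory.ComplexMultiplication
open Summit.HodgeConjecture.CorCM.Census.MultiFieldWeil
open Summit.HodgeConjecture.CorCM.Census.OcticDecicWeilG (n2)
open Summit.HodgeConjecture.CorCM.Census.OcticDecicWeil22
open Summit.HodgeConjecture.CorCM.Census.OcticWeilFourfold (phi₂ phi₂Pre inr_mem_phi₂Pre)
open Summit.HodgeConjecture.CorCM.MultiFieldWeil
open Summit.HodgeConjecture.CorCM.OcticDecicWeilG (e2 im2 realised2 he2_sign he2_conj)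
open Summit.HodgeConjecture.CorCM.OcticWeilFourfold (exists_frame₂ twoTransitive_of_isSimple)
open Summit.HodgeConjecture.CorCM.SexticOcticWeil (card_filter_comp_eq_of_finrank card_filter_cmTypeMap_complexConj)
open Summit.HodgeConjecture.CorCM.SexticDecicWeil (exists_frame_fin₂)

open scoped Classical

/-! ## §0 Reading gen 19ʼs frame `Φ₂ = e₂⁻¹ phi₂` as the Boolean reading at `{0, 1}` -/

/-- `Sum.inr q ∈ phi₂ ⟺ q.2 = [q.1 ∈ {0, 1}]` — the `(2,2)` type of the frame reads at positions `0, 1` over `τ` (and `2, 3` over `τ̄`). [folklore] -/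
theorem inr_mem_phi₂_iff_snd_eq_decide (q : Fin 4 × Bool) : Sum.inr q ∈ phi₂ ↔ q.2 = decide (q.1 = 0 ∨ q.1 = 1) := by
  rw [show phi₂ = phi₂Pre 0 1 from rfl, inr_mem_phi₂Pre]
  obtain ⟨c, b⟩ := q
  cases b
  · simp only [Bool.false_eq_true, false_and, false_or, true_and, ne_eq, false_eq_decide_iff, not_or]
  · simp only [true_and, Bool.true_eq_false, false_and, or_false, true_eq_decide_iff]

/-! ## §1 The frame form -/

section Frames

variable {I : Type} {Kf : I → Type} [∀ i, Field (Kf i)] [∀ i, NumberField (Kf i)] [∀ i, IsCMField (Kf i)]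
  {i₀ : I} {is : Fin 2 → I} {τ : Kf i₀ →+* ℂ}
  {A : Fin (2 + 1) → AbelianVariety ℂ} {Φ : ∀ j : Fin (2 + 1), CMType (Kf (mfSlots i₀ is j))}
  {ι : ∀ j, 𝓞 (Kf (mfSlots i₀ is j)) →+* End (A j)}
  {θ : ∀ j, Kf (mfSlots i₀ is j) →+* Module.End ℂ (complexBetti (A j).X 1)}

/-- **MAIN THEOREM (frame form).  The Hodge conjecture for every product of copies `⨁_j A(κ j)` of `E, B₄, B₅` — GIVEN ONLY Markman's fourfold theorem (the
Weil plane of `B₄`) and hyperbolic-sixfold theorem (that of `B₅ × E`)**, for `E = A 0 ⊨ (k; {τ})`, `B₄ = A 1 ⊨ (K₂; Φ 1)` over an OCTIC `K₂ ⊇ i₂(k)` (TWO members over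
`τ`, positions `0, 1` of `e₂`; `Aut(ℂ)` `2`-transitive on the embeddings over `τ`), `B₅ = A 2 ⊨ (K₃; Φ 2)` over a DECIC `K₃ ⊇ i₃(k)` (two members over `τ`,
positions `0, 1` of `e₃`); NO hypothesis relating the fields.  `HC_CM` is NOT asserted. [cite: Markman2025SurveySecant, Thm. 1.2] [cite: Markman2025SecantWeil, Thm 1.5.1]
[cite: Pohlmann1968, Thm 1] [cite: Milne2020HodgeClassesAV, 1.2 (a) and Thm. 1] -/
theorem hodgeConjectureFor_biproduct_comp_of_frames_of_markman22 (hW4 : Markman2025_weilClasses_algebraic_abelianFourfold)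
    (hM6 : Markman2025_weilClasses_algebraic_hyperbolicSixfold)
    {N : ℕ} (κ : Fin N → Fin (2 + 1)) (h8 : Module.finrank ℚ (Kf (is 0)) = 8) (h10 : Module.finrank ℚ (Kf (is 1)) = 10)
    (h2 : Module.finrank ℚ (Kf i₀) = 2) (i₂ : Kf i₀ →+* Kf (is 0)) (i₃ : Kf i₀ →+* Kf (is 1))
    {δ : 𝓞 (Kf i₀)} {d : ℕ} (hd : 0 < d) (hδ : ((δ : Kf i₀)) ^ 2 = -(d : Kf i₀)) (hτ : τ (δ : Kf i₀) = Complex.I * (Real.sqrt d : ℂ))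
    (hA : ∀ j, IsCMTypeRealisation (Φ j) (A j) (ι j) (θ j))
    (e₂ : (Kf (is 0) →+* ℂ) ≃ Fin 4 × Bool) (e₃ : (Kf (is 1) →+* ℂ) ≃ Fin 5 × Bool)
    (he₂_sign : ∀ s, (e₂ s).2 = true ↔ s.comp i₂ = τ) (he₃_sign : ∀ s, (e₃ s).2 = true ↔ s.comp i₃ = τ)
    (he₂_conj : ∀ s, e₂ (ComplexEmbedding.conjugate s) = ((e₂ s).1, !(e₂ s).2))
    (he₃_conj : ∀ s, e₃ (ComplexEmbedding.conjugate s) = ((e₃ s).1, !(e₃ s).2))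
    (hΨ : ∀ σ : Kf i₀ →+* ℂ, σ ∈ (Φ 0).1 ↔ σ = τ)
    (hΦ₂ : ∀ s : Kf (is 0) →+* ℂ, s ∈ (Φ 1).1 ↔ (e₂ s).2 = decide ((e₂ s).1 = 0 ∨ (e₂ s).1 = 1))
    (hΦ₃ : ∀ s : Kf (is 1) →+* ℂ, s ∈ (Φ 2).1 ↔ (e₃ s).2 = decide ((e₃ s).1 = 0 ∨ (e₃ s).1 = 1))
    (h2T : ∀ s t s' t' : Kf (is 0) →+* ℂ, s.comp i₂ = τ → t.comp i₂ = τ → s'.comp i₂ = τ → t'.comp i₂ = τ → s ≠ t → s' ≠ t' →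
      ∃ ρ : ℂ ≃+* ℂ, (ρ : ℂ →+* ℂ).comp s = s' ∧ (ρ : ℂ →+* ℂ).comp t = t') :
    HodgeConjectureFor (⨁ fun j => A (κ j)).dim (⨁ fun j => A (κ j)).X := by
  -- the two single-slot Weil spaces: the fourfold `B₄` (c = 0) and the sixfold `B₅ × E` (c = 1)
  have hW : ∀ m : Fin 2, weilClassesOf (⨁ fun i => A (partSlots (c22 m) m i))
      (biproduct.map fun i => ι (partSlots (c22 m) m i) (δfam (im2 is i₂ i₃) δ (partSlots (c22 m) m i))) (w22 m) d ≤
      algebraicClasses (⨁ fun i => A (partSlots (c22 m) m i)).X (w22 m) := by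
    intro m
    refine Fin.cases ?_ (fun m => Fin.cases ?_ (fun m => m.elim0) m) m
    · exact weilHyp_of_markman_fourfold22 (im := im2 is i₂ i₃) hW4 0 h8 h2 hd hδ hA e₂ he₂_sign hΦ₂
    · exact weilHyp_of_markman_sixfold_decic (im := im2 is i₂ i₃) hM6 1 h10 h2 hd hδ hA e₃ he₃_sign hΦ₃ hΨ
  exact hodgeConjectureFor_biproduct_comp_of_defectLawG (is := is) P22 c22 w22 n2_add_c22 c22_lt_n2 κ h2 (im2 is i₂ i₃) hτ hA
    (e2 is e₂ e₃) (he2_sign (is := is) he₂_sign he₃_sign) (he2_conj (is := is) he₂_conj he₃_conj) hΨ (hΦ22 (is := is) hΦ₂ hΦ₃)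
    (fun v T hT => exists_hasDefectsG_realisedTuples22 he₂_sign he₃_sign h2T v T hT) hW

/-- **The Hodge conjecture for every abelian variety DOMINATED by a product of copies `⨁_j A(κ j)` of `E, B₄, B₅`** (frame form).
[cite: MumfordAV1970, §19] [cite: Markman2025SurveySecant, Thm. 1.2] [cite: Markman2025SecantWeil, Thm 1.5.1] -/
theorem hodgeConjectureFor_of_avDominatedBy_comp_of_frames_of_markman22 (hW4 : Markman2025_weilClasses_algebraic_abelianFourfold)
    (hM6 : Markman2025_weilClasses_algebraic_hyperbolicSixfold)
    {N : ℕ} (κ : Fin N → Fin (2 + 1)) (h8 : Module.finrank ℚ (Kf (is 0)) = 8) (h10 : Module.finrank ℚ (Kf (is 1)) = 10)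
    (h2 : Module.finrank ℚ (Kf i₀) = 2) (i₂ : Kf i₀ →+* Kf (is 0)) (i₃ : Kf i₀ →+* Kf (is 1))
    {δ : 𝓞 (Kf i₀)} {d : ℕ} (hd : 0 < d) (hδ : ((δ : Kf i₀)) ^ 2 = -(d : Kf i₀)) (hτ : τ (δ : Kf i₀) = Complex.I * (Real.sqrt d : ℂ))
    (hA : ∀ j, IsCMTypeRealisation (Φ j) (A j) (ι j) (θ j))
    (e₂ : (Kf (is 0) →+* ℂ) ≃ Fin 4 × Bool) (e₃ : (Kf (is 1) →+* ℂ) ≃ Fin 5 × Bool)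
    (he₂_sign : ∀ s, (e₂ s).2 = true ↔ s.comp i₂ = τ) (he₃_sign : ∀ s, (e₃ s).2 = true ↔ s.comp i₃ = τ)
    (he₂_conj : ∀ s, e₂ (ComplexEmbedding.conjugate s) = ((e₂ s).1, !(e₂ s).2))
    (he₃_conj : ∀ s, e₃ (ComplexEmbedding.conjugate s) = ((e₃ s).1, !(e₃ s).2))
    (hΨ : ∀ σ : Kf i₀ →+* ℂ, σ ∈ (Φ 0).1 ↔ σ = τ)
    (hΦ₂ : ∀ s : Kf (is 0) →+* ℂ, s ∈ (Φ 1).1 ↔ (e₂ s).2 = decide ((e₂ s).1 = 0 ∨ (e₂ s).1 = 1))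
    (hΦ₃ : ∀ s : Kf (is 1) →+* ℂ, s ∈ (Φ 2).1 ↔ (e₃ s).2 = decide ((e₃ s).1 = 0 ∨ (e₃ s).1 = 1))
    (h2T : ∀ s t s' t' : Kf (is 0) →+* ℂ, s.comp i₂ = τ → t.comp i₂ = τ → s'.comp i₂ = τ → t'.comp i₂ = τ → s ≠ t → s' ≠ t' →
      ∃ ρ : ℂ ≃+* ℂ, (ρ : ℂ →+* ℂ).comp s = s' ∧ (ρ : ℂ →+* ℂ).comp t = t')
    {X : AbelianVariety ℂ} (hX : Domination.AVDominatedBy X (⨁ fun j => A (κ j))) : HodgeConjectureFor X.dim X.X :=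
  Domination.hodgeConjectureFor_of_avDominatedBy
    (hodgeConjectureFor_biproduct_comp_of_frames_of_markman22 hW4 hM6 κ h8 h10 h2 i₂ i₃ hd hδ hτ hA e₂ e₃ he₂_sign he₃_sign he₂_conj he₃_conj
      hΨ hΦ₂ hΦ₃ h2T) hX

end Frames

/-! ## §2 The intrinsic theorems for `⨁_j ![E, B₄, B₅] (κ j)` -/

section Vec

variable {k K₂ K₃ : Type} [Field k] [NumberField k] [IsCMField k] [Field K₂] [NumberField K₂] [IsCMField K₂]
  [Field K₃] [NumberField K₃] [IsCMField K₃] {N : ℕ}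
  {E B₄ B₅ : AbelianVariety ℂ} {Ψ : CMType k} {Φ₂ : CMType K₂} {Φ₃ : CMType K₃}
  {ιE : 𝓞 k →+* End E} {θE : k →+* Module.End ℂ (complexBetti E.X 1)}
  {ιB₄ : 𝓞 K₂ →+* End B₄} {θB₄ : K₂ →+* Module.End ℂ (complexBetti B₄.X 1)}
  {ιB₅ : 𝓞 K₃ →+* End B₅} {θB₅ : K₃ →+* Module.End ℂ (complexBetti B₅.X 1)}

/-- **MAIN THEOREM (intrinsic form).  The Hodge conjecture for every product of copies of `E`, `B₄`, `B₅` — `E^a × B₄^n × B₅^m`, any order (`⨁_j ![E, B₄, B₅] (κ j)`)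
— GIVEN ONLY Markman's fourfold and hyperbolic-sixfold theorems**: `k` imaginary quadratic, `K₂ ⊇ i₂(k)` ANY octic, `K₃ ⊇ i₃(k)` ANY decic CM field, `E ⊨ (k; Ψ)`
(`τ ∈ Ψ`), `B₄ ⊨ (K₂; Φ₂)` with exactly TWO members over `τ` (WEIL TYPE for `k`) and `Aut(ℂ)` `2`-TRANSITIVE on the four embeddings of `K₂` over `τ` (`h2T`),
`B₅ ⊨ (K₃; Φ₃)` with exactly TWO (`(2,3)`).  NO hypothesis relating the fields.  `HC_CM` is NOT asserted. [cite: Markman2025SurveySecant, Thm. 1.2]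
[cite: Markman2025SecantWeil, Thm 1.5.1] [cite: Dodson1984, §3.3.2 Theorem] [cite: Pohlmann1968, Thm 1] -/
theorem hodgeConjectureFor_biproduct_comp_vec_of_markman22 (hW4 : Markman2025_weilClasses_algebraic_abelianFourfold)
    (hM6 : Markman2025_weilClasses_algebraic_hyperbolicSixfold)
    (h2 : Module.finrank ℚ k = 2) (h8 : Module.finrank ℚ K₂ = 8) (h10 : Module.finrank ℚ K₃ = 10) (i₂ : k →+* K₂) (i₃ : k →+* K₃)
    (hE : IsCMTypeRealisation Ψ E ιE θE) (hB₄ : IsCMTypeRealisation Φ₂ B₄ ιB₄ θB₄) (hB₅ : IsCMTypeRealisation Φ₃ B₅ ιB₅ θB₅)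
    {τ : k →+* ℂ} (hτΨ : τ ∈ Ψ.1)
    (h22 : (Finset.univ.filter fun t : K₂ →+* ℂ => t.comp i₂ = τ ∧ t ∈ Φ₂.1).card = 2)
    (h23 : (Finset.univ.filter fun u : K₃ →+* ℂ => u.comp i₃ = τ ∧ u ∈ Φ₃.1).card = 2)
    (h2T : ∀ s t s' t' : K₂ →+* ℂ, s.comp i₂ = τ → t.comp i₂ = τ → s'.comp i₂ = τ → t'.comp i₂ = τ → s ≠ t → s' ≠ t' →
      ∃ ρ : ℂ ≃+* ℂ, (ρ : ℂ →+* ℂ).comp s = s' ∧ (ρ : ℂ →+* ℂ).comp t = t')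
    (κ : Fin N → Fin 3) :
    HodgeConjectureFor (⨁ fun j => (![E, B₄, B₅] : Fin 3 → AbelianVariety ℂ) (κ j)).dim
      (⨁ fun j => (![E, B₄, B₅] : Fin 3 → AbelianVariety ℂ) (κ j)).X := by
  have hττ : ComplexEmbedding.conjugate τ ≠ τ := QuarticCM.conjugate_ne τ
  have hk : ∀ σ : k →+* ℂ, σ = τ ∨ σ = ComplexEmbedding.conjugate τ := fun σ => QuarticCM.eq_or_eq_conjugate_of_quadratic h2 τ σ
  have hΨ : ∀ σ : k →+* ℂ, σ ∈ Ψ.1 ↔ σ = τ := by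
    intro σ
    rcases hk σ with rfl | rfl
    · exact ⟨fun _ => rfl, fun _ => hτΨ⟩
    · exact ⟨fun h => absurd h ((Ψ.2 τ).1 hτΨ), fun h => absurd h hττ⟩
  obtain ⟨δ₀, d, hd, hδ₀⟩ := CyclicSextic.exists_sq_eq_neg_nat_of_isTotallyComplex k h2
  obtain ⟨δ, hδ, hτ⟩ := OcticCurveFourfold.exists_delta_of_mem h2 hd hδ₀ τ
  obtain ⟨e₂, he₂_sign, he₂_conj, hΦ₂'⟩ := exists_frame₂ h8 h2 i₂ hττ hk Φ₂ h22
  have hΦ₂ : ∀ s : K₂ →+* ℂ, s ∈ Φ₂.1 ↔ (e₂ s).2 = decide ((e₂ s).1 = 0 ∨ (e₂ s).1 = 1) := fun s =>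
    (hΦ₂' s).trans (inr_mem_phi₂_iff_snd_eq_decide (e₂ s))
  obtain ⟨e₃, he₃_sign, he₃_conj, hΦ₃⟩ := exists_frame_fin₂ h10 h2 i₃ hττ hk Φ₃ h23
  let Kf : Fin 3 → Type := Fin.cons k (Fin.cons K₂ (Fin.cons K₃ finZeroElim))
  letI instF : ∀ j, Field (Kf j) := Fin.cons ‹Field k› (Fin.cons ‹Field K₂› (Fin.cons ‹Field K₃› finZeroElim))
  letI instN : ∀ j, NumberField (Kf j) := Fin.cons ‹NumberField k› (Fin.cons ‹NumberField K₂› (Fin.cons ‹NumberField K₃› finZeroElim))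
  haveI instC : ∀ j, IsCMField (Kf j) := Fin.cons ‹IsCMField k› (Fin.cons ‹IsCMField K₂› (Fin.cons ‹IsCMField K₃› finZeroElim))
  let Φf : ∀ j : Fin 3, CMType (Kf (mfSlots (0 : Fin 3) Fin.succ j)) := Fin.cons Ψ (Fin.cons Φ₂ (Fin.cons Φ₃ finZeroElim))
  let ιf : ∀ j : Fin 3, 𝓞 (Kf (mfSlots (0 : Fin 3) Fin.succ j)) →+* End ((![E, B₄, B₅] : Fin 3 → AbelianVariety ℂ) j) :=
    Fin.cons ιE (Fin.cons ιB₄ (Fin.cons ιB₅ finZeroElim))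
  let θf : ∀ j : Fin 3, Kf (mfSlots (0 : Fin 3) Fin.succ j) →+* Module.End ℂ (complexBetti ((![E, B₄, B₅] : Fin 3 → AbelianVariety ℂ) j).X 1) :=
    Fin.cons θE (Fin.cons θB₄ (Fin.cons θB₅ finZeroElim))
  have hA : ∀ j, IsCMTypeRealisation (Φf j) ((![E, B₄, B₅] : Fin 3 → AbelianVariety ℂ) j) (ιf j) (θf j) :=
    Fin.cons hE (Fin.cons hB₄ (Fin.cons hB₅ finZeroElim))
  exact hodgeConjectureFor_biproduct_comp_of_frames_of_markman22 (Kf := Kf) (i₀ := (0 : Fin 3)) (is := Fin.succ)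
    (A := (![E, B₄, B₅] : Fin 3 → AbelianVariety ℂ)) (Φ := Φf) (ι := ιf) (θ := θf)
    hW4 hM6 κ h8 h10 h2 i₂ i₃ hd hδ hτ hA e₂ e₃ he₂_sign he₃_sign he₂_conj he₃_conj hΨ hΦ₂ hΦ₃ h2T

/-- **`B₄` SIMPLE: the `2`-transitivity hypothesis is automatic** (Dodson §3.3.2, gen 19ʼs `OcticWeilFourfold.twoTransitive_of_isSimple` BY NAME): the Hodge conjecture
for every `E^a × B₄^n × B₅^m` with `B₄` a SIMPLE CM abelian fourfold of Weil type for `k` over ANY octic CM field and `B₅` a `(2,3)`-fivefold over ANY decic CM field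
sharing `k`, GIVEN ONLY Markman's two theorems.  `HC_CM` is NOT asserted. [cite: Dodson1984, §3.3.2 Theorem] [cite: Markman2025SurveySecant, Thm. 1.2]
[cite: Markman2025SecantWeil, Thm 1.5.1] -/
theorem hodgeConjectureFor_biproduct_comp_vec_of_isSimple_of_markman22 (hW4 : Markman2025_weilClasses_algebraic_abelianFourfold)
    (hM6 : Markman2025_weilClasses_algebraic_hyperbolicSixfold)
    (h2 : Module.finrank ℚ k = 2) (h8 : Module.finrank ℚ K₂ = 8) (h10 : Module.finrank ℚ K₃ = 10) (i₂ : k →+* K₂) (i₃ : k →+* K₃)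
    (hE : IsCMTypeRealisation Ψ E ιE θE) (hB₄ : IsCMTypeRealisation Φ₂ B₄ ιB₄ θB₄) (hS : B₄.IsSimple) (hB₅ : IsCMTypeRealisation Φ₃ B₅ ιB₅ θB₅)
    {τ : k →+* ℂ} (hτΨ : τ ∈ Ψ.1)
    (h22 : (Finset.univ.filter fun t : K₂ →+* ℂ => t.comp i₂ = τ ∧ t ∈ Φ₂.1).card = 2)
    (h23 : (Finset.univ.filter fun u : K₃ →+* ℂ => u.comp i₃ = τ ∧ u ∈ Φ₃.1).card = 2)
    (κ : Fin N → Fin 3) :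
    HodgeConjectureFor (⨁ fun j => (![E, B₄, B₅] : Fin 3 → AbelianVariety ℂ) (κ j)).dim
      (⨁ fun j => (![E, B₄, B₅] : Fin 3 → AbelianVariety ℂ) (κ j)).X :=
  hodgeConjectureFor_biproduct_comp_vec_of_markman22 hW4 hM6 h2 h8 h10 i₂ i₃ hE hB₄ hB₅ hτΨ h22 h23
    (twoTransitive_of_isSimple h8 h2 i₂ hB₄ hS τ h22) κ

/-- **Both `k`-signatures `(2,3)/(3,2)` of `B₅`** via the conjugate CM structure on `B₅` (the `(2,2)` count of `B₄` is self-conjugate). [cite: Markman2025SurveySecant, Thm. 1.2]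
[cite: Markman2025SecantWeil, Thm 1.5.1] [cite: Pohlmann1968, Thm 1] -/
theorem hodgeConjectureFor_biproduct_comp_vec_of_markman22_of_signs (hW4 : Markman2025_weilClasses_algebraic_abelianFourfold)
    (hM6 : Markman2025_weilClasses_algebraic_hyperbolicSixfold)
    (h2 : Module.finrank ℚ k = 2) (h8 : Module.finrank ℚ K₂ = 8) (h10 : Module.finrank ℚ K₃ = 10) (i₂ : k →+* K₂) (i₃ : k →+* K₃)
    (hE : IsCMTypeRealisation Ψ E ιE θE) (hB₄ : IsCMTypeRealisation Φ₂ B₄ ιB₄ θB₄) (hB₅ : IsCMTypeRealisation Φ₃ B₅ ιB₅ θB₅)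
    {τ : k →+* ℂ} (hτΨ : τ ∈ Ψ.1)
    (h22 : (Finset.univ.filter fun t : K₂ →+* ℂ => t.comp i₂ = τ ∧ t ∈ Φ₂.1).card = 2)
    (h23 : (Finset.univ.filter fun u : K₃ →+* ℂ => u.comp i₃ = τ ∧ u ∈ Φ₃.1).card = 2 ∨
      (Finset.univ.filter fun u : K₃ →+* ℂ => u.comp i₃ = τ ∧ u ∈ Φ₃.1).card = 3)
    (h2T : ∀ s t s' t' : K₂ →+* ℂ, s.comp i₂ = τ → t.comp i₂ = τ → s'.comp i₂ = τ → t'.comp i₂ = τ → s ≠ t → s' ≠ t' →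
      ∃ ρ : ℂ ≃+* ℂ, (ρ : ℂ →+* ℂ).comp s = s' ∧ (ρ : ℂ →+* ℂ).comp t = t')
    (κ : Fin N → Fin 3) :
    HodgeConjectureFor (⨁ fun j => (![E, B₄, B₅] : Fin 3 → AbelianVariety ℂ) (κ j)).dim
      (⨁ fun j => (![E, B₄, B₅] : Fin 3 → AbelianVariety ℂ) (κ j)).X := by
  have hn₃ := card_filter_comp_eq_of_finrank (n := 5) i₃ h10 h2 τ
  have hB₅' : ∃ (Φ₃' : CMType K₃) (ι' : 𝓞 K₃ →+* End B₅) (θ' : K₃ →+* Module.End ℂ (complexBetti B₅.X 1)),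
      IsCMTypeRealisation Φ₃' B₅ ι' θ' ∧ (Finset.univ.filter fun u : K₃ →+* ℂ => u.comp i₃ = τ ∧ u ∈ Φ₃'.1).card = 2 := by
    rcases h23 with h | h
    · exact ⟨Φ₃, ιB₅, θB₅, hB₅, h⟩
    · refine ⟨_, _, _, hB₅.transport (IsCMField.complexConj K₃).toRingEquiv, ?_⟩
      rw [card_filter_cmTypeMap_complexConj i₃ τ Φ₃, hn₃, h]
  obtain ⟨Φ₃', ι₅', θ₅', hB₅'', h23'⟩ := hB₅'
  exact hodgeConjectureFor_biproduct_comp_vec_of_markman22 hW4 hM6 h2 h8 h10 i₂ i₃ hE hB₄ hB₅'' hτΨ h22 h23' h2T κ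

/-- **The Hodge conjecture for every abelian variety dominated by a product of copies of `E`, `B₄`, `B₅`** (intrinsic form, both signs of `B₅`), modulo Markman's
fourfold and hyperbolic-sixfold theorems, under `2`-transitivity on the embeddings of `K₂` over `τ`. [cite: MumfordAV1970, §19] [cite: Markman2025SurveySecant, Thm. 1.2]
[cite: Markman2025SecantWeil, Thm 1.5.1] -/
theorem hodgeConjectureFor_of_avDominatedBy_comp_vec_of_markman22 (hW4 : Markman2025_weilClasses_algebraic_abelianFourfold)
    (hM6 : Markman2025_weilClasses_algebraic_hyperbolicSixfold)
    (h2 : Module.finrank ℚ k = 2) (h8 : Module.finrank ℚ K₂ = 8) (h10 : Module.finrank ℚ K₃ = 10) (i₂ : k →+* K₂) (i₃ : k →+* K₃)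
    (hE : IsCMTypeRealisation Ψ E ιE θE) (hB₄ : IsCMTypeRealisation Φ₂ B₄ ιB₄ θB₄) (hB₅ : IsCMTypeRealisation Φ₃ B₅ ιB₅ θB₅)
    {τ : k →+* ℂ} (hτΨ : τ ∈ Ψ.1)
    (h22 : (Finset.univ.filter fun t : K₂ →+* ℂ => t.comp i₂ = τ ∧ t ∈ Φ₂.1).card = 2)
    (h23 : (Finset.univ.filter fun u : K₃ →+* ℂ => u.comp i₃ = τ ∧ u ∈ Φ₃.1).card = 2 ∨
      (Finset.univ.filter fun u : K₃ →+* ℂ => u.comp i₃ = τ ∧ u ∈ Φ₃.1).card = 3)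
    (h2T : ∀ s t s' t' : K₂ →+* ℂ, s.comp i₂ = τ → t.comp i₂ = τ → s'.comp i₂ = τ → t'.comp i₂ = τ → s ≠ t → s' ≠ t' →
      ∃ ρ : ℂ ≃+* ℂ, (ρ : ℂ →+* ℂ).comp s = s' ∧ (ρ : ℂ →+* ℂ).comp t = t')
    (κ : Fin N → Fin 3) {X : AbelianVariety ℂ} (hX : Domination.AVDominatedBy X (⨁ fun j => (![E, B₄, B₅] : Fin 3 → AbelianVariety ℂ) (κ j))) :
    HodgeConjectureFor X.dim X.X :=
  Domination.hodgeConjectureFor_of_avDominatedBy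
    (hodgeConjectureFor_biproduct_comp_vec_of_markman22_of_signs hW4 hM6 h2 h8 h10 i₂ i₃ hE hB₄ hB₅ hτΨ h22 h23 h2T κ) hX

/-- **… and with `B₄` SIMPLE** (no `2`-transitivity hypothesis): everything dominated by some `E^a × B₄^n × B₅^m`. [cite: Dodson1984, §3.3.2 Theorem]
[cite: MumfordAV1970, §19] [cite: Markman2025SurveySecant, Thm. 1.2] [cite: Markman2025SecantWeil, Thm 1.5.1] -/
theorem hodgeConjectureFor_of_avDominatedBy_comp_vec_of_isSimple_of_markman22 (hW4 : Markman2025_weilClasses_algebraic_abelianFourfold)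
    (hM6 : Markman2025_weilClasses_algebraic_hyperbolicSixfold)
    (h2 : Module.finrank ℚ k = 2) (h8 : Module.finrank ℚ K₂ = 8) (h10 : Module.finrank ℚ K₃ = 10) (i₂ : k →+* K₂) (i₃ : k →+* K₃)
    (hE : IsCMTypeRealisation Ψ E ιE θE) (hB₄ : IsCMTypeRealisation Φ₂ B₄ ιB₄ θB₄) (hS : B₄.IsSimple) (hB₅ : IsCMTypeRealisation Φ₃ B₅ ιB₅ θB₅)
    {τ : k →+* ℂ} (hτΨ : τ ∈ Ψ.1)
    (h22 : (Finset.univ.filter fun t : K₂ →+* ℂ => t.comp i₂ = τ ∧ t ∈ Φ₂.1).card = 2)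
    (h23 : (Finset.univ.filter fun u : K₃ →+* ℂ => u.comp i₃ = τ ∧ u ∈ Φ₃.1).card = 2 ∨
      (Finset.univ.filter fun u : K₃ →+* ℂ => u.comp i₃ = τ ∧ u ∈ Φ₃.1).card = 3)
    (κ : Fin N → Fin 3) {X : AbelianVariety ℂ} (hX : Domination.AVDominatedBy X (⨁ fun j => (![E, B₄, B₅] : Fin 3 → AbelianVariety ℂ) (κ j))) :
    HodgeConjectureFor X.dim X.X :=
  hodgeConjectureFor_of_avDominatedBy_comp_vec_of_markman22 hW4 hM6 h2 h8 h10 i₂ i₃ hE hB₄ hB₅ hτΨ h22 h23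
    (twoTransitive_of_isSimple h8 h2 i₂ hB₄ hS τ h22) κ hX

end Vec

end Summit.HodgeConjecture.CorCM.OcticDecicWeil22

end
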